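import Summits.BirchSwinnertonDyer.BirchSwinnertonDyer.Theorems.GenusKolyvaginAtTwoTorsionCellD0PairTwistSymbols
import HarnessLib

/-!
# D0≤2, one genus step: `#Sel⁽²⁾(E₀^{(q₁q₂)}/ℚ) = 4`

Crux R″ `RankOneTwoTorsionResidualAtTwo` (stmt-27478), LINE 49 «full_vertex», stub D0≤2
`FullTorsionGenusSelmerLawUpToTwoAtTwo`, slice `#Q₀ = 2`, the rank-zero twist `C₀ = E₀^{(M₀)}`, `M₀ = q₁q₂`: for a base
`E` with rational `2`-torsion, rank `0`, `Ш(E)[2] = 0`; `S ∋ 2` a finite set of primes supporting the conductor and the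
root differences; two distinct primes `q₁, q₂ ∉ S`, `qᵢ ≡ 3 (mod 4)`, at which `δ₁ = (e₁-e₂)(e₁-e₃)` and
`δ₂ = (e₂-e₁)(e₂-e₃)` are non-residues ("full-admissible"), with `(q₁q₂/ℓ) = 1` for every odd `ℓ ∈ S` and
`q₁q₂ ≡ 1 (mod 8)` (every `ℓ ∣ 2N` split in `ℚ(√(q₁q₂))`): **`#Sel⁽²⁾(E^{(q₁q₂)}/ℚ) = 4`** — the Selmer group of the
twist is the image of its rational `2`-torsion (`natCard_selmerGroup_twist_pair_eq_four`). Proof = LEAD memo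
`D0le2_memo.md` §2(a) (evidence #48 on 27478), a complete `2`-descent (Silverman X.1.4 / X.4.9) on the tree's
cohomological `Sel⁽²⁾`:

* `#Sel⁽²⁾ = 4 · #N_{q₁}` (parity character onto at the twisting prime `q₁`, `…D0PairTwistSymbols`);
* **`eq_zero_of_mem_selmerGroup_twist_pair`**: a `q₁`-unramified Selmer class `c'` of the twist is `0`. Its components
  are residues at `q₁` (`I₀*` relations); writing them as square-free kernels `ε∏_{ℓ∈T} ℓ`, `T ⊆ S ∪ {q₂}`, the
  reciprocity package (R1) (`qr_{q₁} = qr_{q₂}` on `−1`, `2`, `ℓ ∈ S`; `qr_{q₂}(q₁) = qr_{q₁}(q₂) + 1`) turns the `I₀*`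
  relations at `q₂` into `β = α(1+t)`, `α = βt` for the `q₂`-parities `(α, β)`, whence `α = β = 0`; so the
  same-component class of `E` is Selmer (transfer at `S` and `∞` where `q₁q₂` is a square, units elsewhere) with both
  components residues at `q₁`, hence `0` by the residue-kernel lemma for the rank-zero base; so `c' = 0`.

Everything is proved; no LINE 49 statement is restated; BSD is not advanced by this file alone.

## References

* [SilvermanAEC2009] J. H. Silverman, *The Arithmetic of Elliptic Curves*, 2nd ed., GTM 106, Springer 2009,
  Prop. X.1.4, Thm. X.4.2, Prop. X.4.9.
* [Kramer1981] K. Kramer, *Arithmetic of elliptic curves upon quadratic extension*, Trans. AMS 264 (1981), Thm. 1.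
* [MazurRubin2010] B. Mazur, K. Rubin, Invent. Math. 181 (2010), Lemma 2.10, Lemma 2.11, Prop. 3.3.
-/

noncomputable section

open scoped Classical

namespace Summit.BirchSwinnertonDyer.BirchSwinnertonDyer.Theorems.GenusKolyvaginAtTwo.TorsionCellD0

open WeierstrassCurve WeierstrassCurve.Affine WeierstrassCurve.Affine.Point
open Literature.NumberTheory.GaloisRepresentations Literature.NumberTheory.EllipticCurves Field
open Literature.NumberTheory.EllipticCurves.TwoDescentLocal
open Literature.NumberTheory.EllipticCurves.KramerTwoDescent
open IsDedekindDomain NumberField Rat.HeightOneSpectrum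

variable (E : WeierstrassCurve ℚ) [E.IsElliptic] {e₁ e₂ e₃ : ℚ}
variable (S : Finset ℕ) {q₁ q₂ : ℕ} [hq₁ : Fact q₁.Prime] [hq₂ : Fact q₂.Prime]

/-- Residue bit of a square-free kernel at any prime: `qr_q(a) = qr_q(ε) + Σ_{ℓ∈T} qr_q(ℓ)` when `[a] = [ε ∏_T ℓ]`.
[folklore] -/
private theorem qrBit_of_mk_eq_kernel (q : ℕ) [Fact q.Prime] {a : ℚˣ} {ε : ℚ} {T : Finset ℕ} (hT : ∀ ℓ ∈ T, ℓ.Prime)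
    (hε : ε = 1 ∨ ε = -1) (hg : ε * ∏ ℓ ∈ T, (ℓ : ℚ) ≠ 0)
    (hmk : (QuotientGroup.mk a : SqUnits ℚ) = QuotientGroup.mk (Units.mk0 _ hg)) :
    qrBit q (a : ℚ) = qrBit q ε + ∑ ℓ ∈ T, qrBit q (ℓ : ℚ) := by
  have hε0 : ε ≠ 0 := by rcases hε with h | h <;> rw [h] <;> norm_num
  have hprod0 : ∀ ℓ ∈ T, (ℓ : ℚ) ≠ 0 := fun ℓ hℓ => by exact_mod_cast (hT ℓ hℓ).ne_zero
  rw [qrBit_eq_of_mk_eq q hmk, Units.val_mk0, qrBit_mul q hε0 (Finset.prod_ne_zero_iff.mpr hprod0), qrBit_prod q T _ hprod0]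

/-- `qr_q(ε)` for `ε = ±1` does not depend on the prime `q ≡ 3 (mod 4)`... more precisely `qr_{q₁}(ε) = qr_{q₂}(ε)` when
both `qr_{qᵢ}(−1) = 1`. [folklore] -/
private theorem qrBit_sign_eq {ε : ℚ} (hε : ε = 1 ∨ ε = -1) (h₁ : qrBit q₁ (-1 : ℚ) = 1) (h₂ : qrBit q₂ (-1 : ℚ) = 1) :
    qrBit q₁ ε = qrBit q₂ ε := by
  rcases hε with h | h
  · rw [h, show (1 : ℚ) = 1 * 1 by norm_num, qrBit_mul_self, qrBit_mul_self]
  · rw [h, h₁, h₂]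

/-- An `S`-supported square-free kernel `ε ∏_{ℓ∈T} ℓ` as an integer (copy of the private helper of
`…D0NegPrimeTwistClasses`). [folklore] -/
private theorem kernel_intCast {T : Finset ℕ} {ε : ℚ} (hε : ε = 1 ∨ ε = -1) :
    ∃ m : ℤ, (m : ℚ) = ε * ∏ ℓ ∈ T, (ℓ : ℚ) ∧ ∀ q : ℕ, q.Prime → q ∉ T → (∀ ℓ ∈ T, ℓ.Prime) → ¬ (q : ℤ) ∣ m := by
  have hεZ : ∃ e : ℤ, (e : ℚ) = ε ∧ (e = 1 ∨ e = -1) := by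
    rcases hε with h1 | h1
    · exact ⟨1, by rw [h1]; norm_num, Or.inl rfl⟩
    · exact ⟨-1, by rw [h1]; norm_num, Or.inr rfl⟩
  obtain ⟨e, he, he1⟩ := hεZ
  refine ⟨e * ∏ ℓ ∈ T, (ℓ : ℤ), by rw [← he]; push_cast; rfl, ?_⟩
  intro q hq hqT hTp hdvd
  have hqprime : Prime (q : ℤ) := Nat.prime_iff_prime_int.mp hq
  rcases hqprime.dvd_or_dvd hdvd with h1 | h2
  · rcases he1 with rfl | rfl
    · exact hq.ne_one (by exact_mod_cast Int.eq_one_of_dvd_one (by positivity) h1)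
    · exact hq.ne_one (by exact_mod_cast Int.eq_one_of_dvd_one (by positivity) (Int.dvd_neg.mp h1))
  · obtain ⟨ℓ, hℓT, hℓ⟩ := (Prime.dvd_finsetProd_iff hqprime _).mp h2
    have := (Nat.prime_dvd_prime_iff_eq hq (hTp ℓ hℓT)).mp (Int.natCast_dvd_natCast.mp hℓ)
    exact hqT (this ▸ hℓT)

/-- The two `I₀*` relations at `q₂` in reciprocity-normalised form force both `q₂`-parities to vanish:
`αu = α(u+1+t) + β`, `βu = α + β(u+1+(t+1))` in `ℤ/2` ⟹ `α = β = 0`. [folklore] -/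
private theorem bits_eq_zero (α β t u : ZMod 2) (h1 : α * u = α * (u + 1 + t) + β * 1)
    (h2 : β * u = α * 1 + β * (u + 1 + (t + 1))) : α = 0 ∧ β = 0 := by
  revert α β t u h1 h2; decide

/-- **A `q₁`-unramified Selmer class of `E^{(q₁q₂)}` is trivial** (the heart of D0≤2 at `#Q₀ = 2`; hypotheses as in
the module docstring): for `c' ∈ Sel⁽²⁾(E^{(q₁q₂)}/ℚ)` with components `([a],[b])` of even `q₁`-valuation, `c' = 0`.
[cite: SilvermanAEC2009, Prop. X.1.4, Thm. X.4.2, Prop. X.4.9] [cite: MazurRubin2010, Lemma 2.10, Lemma 2.11] -/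
theorem eq_zero_of_mem_selmerGroup_twist_pair (h : E.toAffine.SplitTwoTorsion e₁ e₂ e₃) (hS : ∀ q ∈ S, q.Prime)
    (h2S : 2 ∈ S)
    (hgood : ∀ ℓ : ℕ, (hℓ : ℓ.Prime) → ℓ ∉ S → haveI : Fact ℓ.Prime := ⟨hℓ⟩;
      padicValRat ℓ (e₁ - e₂) = 0 ∧ padicValRat ℓ (e₁ - e₃) = 0 ∧ padicValRat ℓ (e₂ - e₃) = 0)
    (hN : ∀ ℓ : ℕ, ℓ.Prime → ℓ ∉ S → ¬ ℓ ∣ E.conductorNorm ℤ)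
    (hrank : E.mordellWeilRank = 0) (hsha : ∀ x ∈ E.sha, (2 : ℕ) • x = 0 → x = 0)
    (hq₁S : q₁ ∉ S) (hq₂S : q₂ ∉ S) (hne : q₁ ≠ q₂) (hq₁4 : q₁ % 4 = 3) (hq₂4 : q₂ % 4 = 3)
    (hM8 : ((q₁ : ℤ) * q₂) % 8 = 1)
    (hsplit : ∀ ℓ ∈ S, (hℓ : ℓ.Prime) → ℓ ≠ 2 → haveI : Fact ℓ.Prime := ⟨hℓ⟩; legendreSym ℓ ((q₁ : ℤ) * q₂) = 1)
    (hδ₁₁ : qrBit q₁ ((e₁ - e₂) * (e₁ - e₃)) = 1) (hδ₂₁ : qrBit q₁ ((e₂ - e₁) * (e₂ - e₃)) = 1)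
    (hδ₁₂ : qrBit q₂ ((e₁ - e₂) * (e₁ - e₃)) = 1) (hδ₂₂ : qrBit q₂ ((e₂ - e₁) * (e₂ - e₃)) = 1)
    [(E.quadraticTwist ((q₁ : ℚ) * q₂)).IsElliptic]
    {c' : galH1Torsion (E.quadraticTwist ((q₁ : ℚ) * q₂)) 2} (hc' : c' ∈ selmerGroup (E.quadraticTwist ((q₁ : ℚ) * q₂)) 2)
    (a b : ℚˣ)
    (ha : kummerEquiv ℚ 2 ((E.quadraticTwist ((q₁ : ℚ) * q₂)).twoTorsionCharH1 (h.quadraticTwist ((q₁ : ℚ) * q₂)) c') =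
      Additive.ofMul (QuotientGroup.mk a))
    (hb : kummerEquiv ℚ 2 ((E.quadraticTwist ((q₁ : ℚ) * q₂)).twoTorsionCharH1 (h.quadraticTwist ((q₁ : ℚ) * q₂)).swap₁₂ c') =
      Additive.ofMul (QuotientGroup.mk b))
    (hpa : parityBit q₁ (a : ℚ) = 0) (hpb : parityBit q₁ (b : ℚ) = 0) : c' = 0 := by
  have h' := h.quadraticTwist ((q₁ : ℚ) * q₂)
  have hq₁2 : q₁ ≠ 2 := by rintro rfl; norm_num at hq₁4
  have hq₂2 : q₂ ≠ 2 := by rintro rfl; norm_num at hq₂4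
  have hq₁0 : (q₁ : ℚ) ≠ 0 := by exact_mod_cast hq₁.out.ne_zero
  have hq₂0 : (q₂ : ℚ) ≠ 0 := by exact_mod_cast hq₂.out.ne_zero
  have hM0 : (q₁ : ℚ) * q₂ ≠ 0 := mul_ne_zero hq₁0 hq₂0
  have hMpos : (0 : ℚ) < (q₁ : ℚ) * q₂ := by positivity
  have he12 : e₁ - e₂ ≠ 0 := sub_ne_zero.mpr h.ne₁₂
  have he21 : e₂ - e₁ ≠ 0 := sub_ne_zero.mpr h.ne₁₂.symm
  -- valuations of `M = q₁ q₂`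
  have hv₁ : padicValRat q₁ ((q₁ : ℚ) * q₂) = 1 := by
    rw [padicValRat.mul hq₁0 hq₂0, padicValRat.self hq₁.out.one_lt, show (q₂ : ℚ) = ((q₂ : ℕ) : ℚ) from rfl,
      padicValRat.of_nat]
    have := padicValNat_primes (p := q₁) (q := q₂) hne
    rw [this]; rfl
  have hv₂ : padicValRat q₂ ((q₁ : ℚ) * q₂) = 1 := by
    rw [padicValRat.mul hq₁0 hq₂0, padicValRat.self hq₂.out.one_lt, show (q₁ : ℚ) = ((q₁ : ℕ) : ℚ) from rfl,
      padicValRat.of_nat]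
    have := padicValNat_primes (p := q₂) (q := q₁) (Ne.symm hne)
    rw [this]; simp
  obtain ⟨g12₁, g13₁, g23₁⟩ := hgood q₁ hq₁.out hq₁S
  obtain ⟨g12₂, g13₂, g23₂⟩ := hgood q₂ hq₂.out hq₂S
  -- root differences of the twist are units off `S ∪ {q₁, q₂}`
  set S' : Finset ℕ := insert q₁ (insert q₂ S) with hS'
  have hS'p : ∀ q ∈ S', q.Prime := fun q hq => by
    rcases Finset.mem_insert.mp hq with rfl | hq
    · exact hq₁.out
    rcases Finset.mem_insert.mp hq with rfl | hq
    · exact hq₂.out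
    · exact hS q hq
  have hgood' : ∀ ℓ : ℕ, (hℓ : ℓ.Prime) → ℓ ∉ S' → haveI : Fact ℓ.Prime := ⟨hℓ⟩;
      padicValRat ℓ ((q₁ : ℚ) * q₂ * e₁ - (q₁ : ℚ) * q₂ * e₂) = 0 ∧
        padicValRat ℓ ((q₁ : ℚ) * q₂ * e₁ - (q₁ : ℚ) * q₂ * e₃) = 0 ∧
        padicValRat ℓ ((q₁ : ℚ) * q₂ * e₂ - (q₁ : ℚ) * q₂ * e₃) = 0 := by
    intro ℓ hℓ hℓS'
    haveI : Fact ℓ.Prime := ⟨hℓ⟩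
    simp only [hS', Finset.mem_insert, not_or] at hℓS'
    obtain ⟨hℓ₁, hℓ₂, hℓS⟩ := hℓS'
    obtain ⟨g12, g13, g23⟩ := hgood ℓ hℓ hℓS
    have hvM : padicValRat ℓ ((q₁ : ℚ) * q₂) = 0 := by
      rw [padicValRat.mul hq₁0 hq₂0, show (q₁ : ℚ) = ((q₁ : ℕ) : ℚ) from rfl, show (q₂ : ℚ) = ((q₂ : ℕ) : ℚ) from rfl,
        padicValRat.of_nat, padicValRat.of_nat]
      have h1 := padicValNat_primes (p := ℓ) (q := q₁) hℓ₁
      have h2 := padicValNat_primes (p := ℓ) (q := q₂) hℓ₂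
      rw [h1, h2]; rfl
    refine ⟨?_, ?_, ?_⟩
    · rw [← mul_sub, padicValRat.mul hM0 he12, hvM, g12, add_zero]
    · rw [← mul_sub, padicValRat.mul hM0 (sub_ne_zero.mpr h.ne₁₃), hvM, g13, add_zero]
    · rw [← mul_sub, padicValRat.mul hM0 (sub_ne_zero.mpr h.ne₂₃), hvM, g23, add_zero]
  -- (2) residues at `q₁` vanish
  obtain ⟨hqa₁, hqb₁⟩ := E.qrBit_eq_zero_quadraticTwist_of_parityBit_eq_zero h (q := q₁) hv₁ g12₁ g13₁ g23₁ hc' a b ha hb hpa hpb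
  -- (3) square-free kernels relative to `S'`
  obtain ⟨Ta, hTaS, εa, hεa, -, hga, hmka, hpara, -⟩ := (E.quadraticTwist ((q₁ : ℚ) * q₂)).exists_kernel_of_mem_selmerGroup
    h' S' hS'p (fun ℓ hℓ hℓS => ⟨(hgood' ℓ hℓ hℓS).1, (hgood' ℓ hℓ hℓS).2.1⟩) hc' a ha
  obtain ⟨Tb, hTbS, εb, hεb, -, hgb, hmkb, hparb, -⟩ := (E.quadraticTwist ((q₁ : ℚ) * q₂)).exists_kernel_of_mem_selmerGroup
    h'.swap₁₂ S' hS'p (fun ℓ hℓ hℓS => ⟨by rw [← neg_sub, padicValRat.neg]; exact (hgood' ℓ hℓ hℓS).1, (hgood' ℓ hℓ hℓS).2.2⟩)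
    hc' b hb
  have hTap : ∀ ℓ ∈ Ta, ℓ.Prime := fun ℓ hℓ => hS'p ℓ (hTaS hℓ)
  have hTbp : ∀ ℓ ∈ Tb, ℓ.Prime := fun ℓ hℓ => hS'p ℓ (hTbS hℓ)
  have hq₁Ta : q₁ ∉ Ta := fun hT => by have := hpara q₁; rw [if_pos hT] at this; rw [this] at hpa; exact one_ne_zero hpa
  have hq₁Tb : q₁ ∉ Tb := fun hT => by have := hparb q₁; rw [if_pos hT] at this; rw [this] at hpb; exact one_ne_zero hpb
  -- (R1) termwise: for `ℓ ∈ T ∖ {q₂}`, `qr_{q₁}(ℓ) = qr_{q₂}(ℓ)`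
  have hm1₁ := qrBit_neg_one_eq_one_of_emod_four hq₁4
  have hm1₂ := qrBit_neg_one_eq_one_of_emod_four hq₂4
  have hR1 : ∀ ℓ ∈ S, qrBit q₁ (ℓ : ℚ) = qrBit q₂ (ℓ : ℚ) := by
    intro ℓ hℓ
    by_cases hℓ2 : ℓ = 2
    · subst hℓ2; exact_mod_cast qrBit_two_eq_qrBit_two_of_mul_emod_eight hq₁4 hq₂4 hM8
    · exact qrBit_eq_qrBit_of_legendreSym_mul_eq_one hq₁4 hq₂4 (hS ℓ hℓ) hℓ2 (fun h => hq₁S (h ▸ hℓ))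
        (fun h => hq₂S (h ▸ hℓ)) (hsplit ℓ hℓ (hS ℓ hℓ) hℓ2)
  set u := qrBit q₁ (q₂ : ℚ) with hu
  have hu' : qrBit q₂ (q₁ : ℚ) = u + 1 := qrBit_swap_eq_add_one hq₁4 hq₂4 hne
  have hqq : qrBit q₂ (q₂ : ℚ) = 0 := by
    rw [qrBit, TwoDescentLocal.res, unitPart, show (q₂ : ℚ) = ((q₂ : ℕ) : ℚ) from rfl, padicValRat.of_nat, padicValNat_self,
      Nat.cast_one, zpow_one, div_self hq₂0, Rat.cast_one, if_neg]
    rw [MulChar.map_one]; norm_num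
  -- the termwise difference over a kernel set `T ⊆ S ∪ {q₂}` with `q₁ ∉ T`
  have hdiff : ∀ (T : Finset ℕ), T ⊆ S' → q₁ ∉ T →
      ∑ ℓ ∈ T, qrBit q₁ (ℓ : ℚ) + ∑ ℓ ∈ T, qrBit q₂ (ℓ : ℚ) = if q₂ ∈ T then u else 0 := by
    intro T hT hq₁T
    rw [← Finset.sum_add_distrib, ← Finset.sum_ite_eq' T q₂ (fun _ => u)]
    refine Finset.sum_congr rfl fun ℓ hℓ => ?_
    by_cases hℓq : ℓ = q₂
    · subst hℓq; rw [if_pos rfl, hqq, add_zero]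
    · rw [if_neg hℓq]
      have hℓS : ℓ ∈ S := by
        have := hT hℓ
        simp only [hS', Finset.mem_insert] at this
        rcases this with rfl | rfl | h3
        · exact absurd hℓ hq₁T
        · exact absurd rfl hℓq
        · exact h3
      rw [hR1 ℓ hℓS, ← two_mul]
      have : (2 : ZMod 2) = 0 := rfl
      rw [this, zero_mul]
  -- (5) expansions: `qr_{q₂}(a) = α u`, `qr_{q₂}(b) = β u`
  set α := parityBit q₂ (a : ℚ) with hα
  set β := parityBit q₂ (b : ℚ) with hβ
  have hαT : α = if q₂ ∈ Ta then 1 else 0 := hpara q₂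
  have hβT : β = if q₂ ∈ Tb then 1 else 0 := hparb q₂
  have hA₂ : qrBit q₂ (a : ℚ) = α * u := by
    have e1 := qrBit_of_mk_eq_kernel q₁ hTap hεa hga hmka
    have e2 := qrBit_of_mk_eq_kernel q₂ hTap hεa hga hmka
    have hs := hdiff Ta hTaS hq₁Ta
    rw [hqa₁, qrBit_sign_eq hεa hm1₁ hm1₂] at e1
    -- `e1 : 0 = qr₂ ε + Σ₁`, `e2 : qr₂ a = qr₂ ε + Σ₂`, `hs : Σ₁ + Σ₂ = [q₂ ∈ Ta] u`
    have : qrBit q₂ (a : ℚ) = (qrBit q₂ εa + ∑ ℓ ∈ Ta, qrBit q₁ (ℓ : ℚ)) + (qrBit q₂ εa + ∑ ℓ ∈ Ta, qrBit q₂ (ℓ : ℚ)) := by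
      rw [← e1, zero_add, e2]
    rw [this, add_add_add_comm, ← two_mul, show (2 : ZMod 2) = 0 from rfl, zero_mul, zero_add, hs, hαT]
    split_ifs <;> simp
  have hB₂ : qrBit q₂ (b : ℚ) = β * u := by
    have e1 := qrBit_of_mk_eq_kernel q₁ hTbp hεb hgb hmkb
    have e2 := qrBit_of_mk_eq_kernel q₂ hTbp hεb hgb hmkb
    have hs := hdiff Tb hTbS hq₁Tb
    rw [hqb₁, qrBit_sign_eq hεb hm1₁ hm1₂] at e1
    have : qrBit q₂ (b : ℚ) = (qrBit q₂ εb + ∑ ℓ ∈ Tb, qrBit q₁ (ℓ : ℚ)) + (qrBit q₂ εb + ∑ ℓ ∈ Tb, qrBit q₂ (ℓ : ℚ)) := by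
      rw [← e1, zero_add, e2]
    rw [this, add_add_add_comm, ← two_mul, show (2 : ZMod 2) = 0 from rfl, zero_mul, zero_add, hs, hβT]
    split_ifs <;> simp
  -- (4) the `I₀*` relations at `q₂`
  obtain ⟨R1, R2⟩ := E.qrBit_rel_quadraticTwist_of_mem_selmerGroup h (q := q₂) hv₂ g12₂ g13₂ g23₂ hc' a b ha hb
  have hqM : qrBit q₂ ((q₁ : ℚ) * q₂) = u + 1 := by rw [qrBit_mul q₂ hq₁0 hq₂0, hu', hqq, add_zero]
  set t := qrBit q₂ (e₂ - e₁) with ht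
  have ht' : qrBit q₂ (e₁ - e₂) = t + 1 := by
    rw [show e₁ - e₂ = (-1) * (e₂ - e₁) by ring, qrBit_mul q₂ (by norm_num) he21, hm1₂, ht, add_comm]
  rw [hA₂, ← hα, ← hβ, hqM, hδ₁₂] at R1
  rw [hB₂, ← hα, ← hβ, hqM, hδ₂₂, ht'] at R2
  -- (6) solve: `α = β = 0`
  obtain ⟨hα0, hβ0⟩ := bits_eq_zero α β t u R1 R2
  -- (7) `q₂ ∉ T`, so `T ⊆ S`
  have hq₂Ta : q₂ ∉ Ta := fun hT => by rw [hαT, if_pos hT] at hα0; exact one_ne_zero hα0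
  have hq₂Tb : q₂ ∉ Tb := fun hT => by rw [hβT, if_pos hT] at hβ0; exact one_ne_zero hβ0
  have hTaS0 : Ta ⊆ S := fun ℓ hℓ => by
    have := hTaS hℓ; simp only [hS', Finset.mem_insert] at this
    rcases this with rfl | rfl | h3
    · exact absurd hℓ hq₁Ta
    · exact absurd hℓ hq₂Ta
    · exact h3
  have hTbS0 : Tb ⊆ S := fun ℓ hℓ => by
    have := hTbS hℓ; simp only [hS', Finset.mem_insert] at this
    rcases this with rfl | rfl | h3
    · exact absurd hℓ hq₁Tb
    · exact absurd hℓ hq₂Tb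
    · exact h3
  -- (8) the same-component class of `E` is Selmer
  obtain ⟨ma, hma, hmadiv⟩ := kernel_intCast (T := Ta) hεa
  obtain ⟨mb, hmb, hmbdiv⟩ := kernel_intCast (T := Tb) hεb
  have hma0 : (ma : ℚ) ≠ 0 := by rw [hma]; exact hga
  have hmb0 : (mb : ℚ) ≠ 0 := by rw [hmb]; exact hgb
  have hmka' : (QuotientGroup.mk a : SqUnits ℚ) = QuotientGroup.mk (Units.mk0 (ma : ℚ) hma0) := by
    rw [hmka]; congr 1; exact Units.ext (by rw [Units.val_mk0, Units.val_mk0, hma])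
  have hmkb' : (QuotientGroup.mk b : SqUnits ℚ) = QuotientGroup.mk (Units.mk0 (mb : ℚ) hmb0) := by
    rw [hmkb]; congr 1; exact Units.ext (by rw [Units.val_mk0, Units.val_mk0, hmb])
  have hc'eq : c' = (E.quadraticTwist ((q₁ : ℚ) * q₂)).twoDescentClass h' a b :=
    (E.quadraticTwist ((q₁ : ℚ) * q₂)).eq_twoDescentClass_of_kummerEquiv_eq h' a b ha hb
  have hcE : E.twoDescentClass h a b ∈ E.selmerGroup 2 := by
    rw [mem_selmerGroup_iff]
    refine ⟨fun v => ?_, fun w => ?_⟩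
    · by_cases hvS : (primesEquiv v : ℕ) ∈ S
      · have hsq : IsSquare (algebraMap ℚ (v.adicCompletion ℚ) ((q₁ : ℚ) * q₂)) := by
          by_cases hv2 : (primesEquiv v : ℕ) = 2
          · exact isSquare_mul_adicCompletion_two hq₁4 hq₂4 hM8 v hv2
          · haveI : Fact (primesEquiv v : ℕ).Prime := ⟨(primesEquiv v).2⟩
            exact isSquare_mul_adicCompletion_of_legendreSym v rfl hv2 (fun h => hq₁S (h ▸ hvS)) (fun h => hq₂S (h ▸ hvS))
              (hsplit _ hvS (primesEquiv v).2 hv2)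
        have hloc : (E.quadraticTwist ((q₁ : ℚ) * q₂)).twoDescentClass h' a b ∈
            selmerLocalKer (E.quadraticTwist ((q₁ : ℚ) * q₂)) (v.adicCompletion ℚ) 2 := by
          rw [← hc'eq]; exact ((mem_selmerGroup_iff _ _ _).mp hc').1 v
        exact (E.twoDescentClass_quadraticTwist_mem_selmerLocalKer_iff (v.adicCompletion ℚ)
          (charZero_of_injective_algebraMap (algebraMap ℚ _).injective) h hsq a b).mp hloc
      · have hℓ := (primesEquiv v).2
        have hℓ2 : (primesEquiv v : ℕ) ≠ 2 := fun h2 => hvS (h2 ▸ h2S)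
        have hgoodv : E.HasGoodReductionAt v := by
          by_contra hbad; exact hN _ hℓ hvS ((E.dvd_conductorNorm_iff v).mpr hbad)
        exact E.twoDescentClass_mem_selmerLocalKer_of_mk_eq_intCast h v hℓ2 hgoodv a b ma mb hma0 hmb0 hmka' hmkb'
          (hmadiv _ hℓ (fun hT => hvS (hTaS0 hT)) (fun ℓ hℓ => hS ℓ (hTaS0 hℓ)))
          (hmbdiv _ hℓ (fun hT => hvS (hTbS0 hT)) (fun ℓ hℓ => hS ℓ (hTbS0 hℓ)))
    · -- the real place: `q₁q₂ > 0` is a square in `ℝ`, transfer from the twist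
      have hsq : IsSquare (algebraMap ℚ w.Completion ((q₁ : ℚ) * q₂)) := isSquare_algebraMap_completion_of_pos w hMpos
      have hloc : (E.quadraticTwist ((q₁ : ℚ) * q₂)).twoDescentClass h' a b ∈
          selmerLocalKer (E.quadraticTwist ((q₁ : ℚ) * q₂)) w.Completion 2 := by
        rw [← hc'eq]; exact ((mem_selmerGroup_iff _ _ _).mp hc').2 w
      exact (E.twoDescentClass_quadraticTwist_mem_selmerLocalKer_iff w.Completion
        (charZero_of_injective_algebraMap (algebraMap ℚ _).injective) h hsq a b).mp hloc
  -- (9) residues at `q₁` vanish ⟹ the class of `E` is `0`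
  have hc0 : E.twoDescentClass h a b = 0 :=
    E.eq_zero_of_mem_selmerGroup_of_qrBit_eq_zero h hrank hsha hm1₁ hδ₁₁ hδ₂₁ hcE a b
      (E.kummerEquiv_twoTorsionCharH1_twoDescentClass h a b) (E.kummerEquiv_twoTorsionCharH1_swap_twoDescentClass h a b) hqa₁ hqb₁
  -- (10) so `[a] = [b] = 1` and `c' = 0`
  have ha1 : (QuotientGroup.mk a : SqUnits ℚ) = QuotientGroup.mk 1 := by
    have := E.kummerEquiv_twoTorsionCharH1_twoDescentClass h a b
    rw [hc0, _root_.map_zero, _root_.map_zero] at this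
    rw [QuotientGroup.mk_one]; exact Additive.ofMul.injective (this.symm.trans ofMul_one.symm)
  have hb1 : (QuotientGroup.mk b : SqUnits ℚ) = QuotientGroup.mk 1 := by
    have := E.kummerEquiv_twoTorsionCharH1_swap_twoDescentClass h a b
    rw [hc0, _root_.map_zero, _root_.map_zero] at this
    rw [QuotientGroup.mk_one]; exact Additive.ofMul.injective (this.symm.trans ofMul_one.symm)
  refine (E.quadraticTwist ((q₁ : ℚ) * q₂)).eq_of_kummerEquiv_twoTorsionCharH1_pair_eq h' 1 1
    (by rw [ha, ha1]) (by rw [hb, hb1]) ?_ ?_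
  · rw [_root_.map_zero, _root_.map_zero, QuotientGroup.mk_one, ofMul_one]
  · rw [_root_.map_zero, _root_.map_zero, QuotientGroup.mk_one, ofMul_one]

/-- **`#Sel⁽²⁾(E₀^{(q₁q₂)}/ℚ) = 4`** — D0≤2 at `#Q₀ = 2` for the rank-zero genus twist `C₀` (hypotheses as in the module
docstring): the `2`-Selmer group of the twist is the image of its full rational `2`-torsion.
[cite: SilvermanAEC2009, Prop. X.1.4, Thm. X.4.2, Prop. X.4.9] [cite: MazurRubin2010, Lemma 2.10, Lemma 2.11] -/
theorem natCard_selmerGroup_twist_pair_eq_four (h : E.toAffine.SplitTwoTorsion e₁ e₂ e₃) (hS : ∀ q ∈ S, q.Prime)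
    (h2S : 2 ∈ S)
    (hgood : ∀ ℓ : ℕ, (hℓ : ℓ.Prime) → ℓ ∉ S → haveI : Fact ℓ.Prime := ⟨hℓ⟩;
      padicValRat ℓ (e₁ - e₂) = 0 ∧ padicValRat ℓ (e₁ - e₃) = 0 ∧ padicValRat ℓ (e₂ - e₃) = 0)
    (hN : ∀ ℓ : ℕ, ℓ.Prime → ℓ ∉ S → ¬ ℓ ∣ E.conductorNorm ℤ)
    (hrank : E.mordellWeilRank = 0) (hsha : ∀ x ∈ E.sha, (2 : ℕ) • x = 0 → x = 0)
    (hq₁S : q₁ ∉ S) (hq₂S : q₂ ∉ S) (hne : q₁ ≠ q₂) (hq₁4 : q₁ % 4 = 3) (hq₂4 : q₂ % 4 = 3)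
    (hM8 : ((q₁ : ℤ) * q₂) % 8 = 1)
    (hsplit : ∀ ℓ ∈ S, (hℓ : ℓ.Prime) → ℓ ≠ 2 → haveI : Fact ℓ.Prime := ⟨hℓ⟩; legendreSym ℓ ((q₁ : ℤ) * q₂) = 1)
    (hδ₁₁ : qrBit q₁ ((e₁ - e₂) * (e₁ - e₃)) = 1) (hδ₂₁ : qrBit q₁ ((e₂ - e₁) * (e₂ - e₃)) = 1)
    (hδ₁₂ : qrBit q₂ ((e₁ - e₂) * (e₁ - e₃)) = 1) (hδ₂₂ : qrBit q₂ ((e₂ - e₁) * (e₂ - e₃)) = 1)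
    [(E.quadraticTwist ((q₁ : ℚ) * q₂)).IsElliptic] :
    Nat.card (selmerGroup (E.quadraticTwist ((q₁ : ℚ) * q₂)) 2) = 4 := by
  have h' := h.quadraticTwist ((q₁ : ℚ) * q₂)
  have hq₁0 : (q₁ : ℚ) ≠ 0 := by exact_mod_cast hq₁.out.ne_zero
  have hq₂0 : (q₂ : ℚ) ≠ 0 := by exact_mod_cast hq₂.out.ne_zero
  have hv₁ : padicValRat q₁ ((q₁ : ℚ) * q₂) = 1 := by
    rw [padicValRat.mul hq₁0 hq₂0, padicValRat.self hq₁.out.one_lt, show (q₂ : ℚ) = ((q₂ : ℕ) : ℚ) from rfl,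
      padicValRat.of_nat]
    have := padicValNat_primes (p := q₁) (q := q₂) hne
    rw [this]; rfl
  rw [natCard_selmerGroup_quadraticTwist_eq_four_mul E h hv₁ (hgood q₁ hq₁.out hq₁S)]
  -- the `q₁`-unramified part is `{0}`
  set N := {c : galH1Torsion (E.quadraticTwist ((q₁ : ℚ) * q₂)) 2 // c ∈ selmerGroup (E.quadraticTwist ((q₁ : ℚ) * q₂)) 2 ∧
      parityHom q₁ (kummerEquiv ℚ 2 ((E.quadraticTwist ((q₁ : ℚ) * q₂)).twoTorsionCharH1 h' c)) = 0 ∧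
      parityHom q₁ (kummerEquiv ℚ 2 ((E.quadraticTwist ((q₁ : ℚ) * q₂)).twoTorsionCharH1 h'.swap₁₂ c)) = 0} with hNdef
  suffices hN1 : Nat.card N = 1 by rw [hN1]
  have h0 : (0 : galH1Torsion (E.quadraticTwist ((q₁ : ℚ) * q₂)) 2) ∈ selmerGroup (E.quadraticTwist ((q₁ : ℚ) * q₂)) 2 ∧
      parityHom q₁ (kummerEquiv ℚ 2 ((E.quadraticTwist ((q₁ : ℚ) * q₂)).twoTorsionCharH1 h' 0)) = 0 ∧
      parityHom q₁ (kummerEquiv ℚ 2 ((E.quadraticTwist ((q₁ : ℚ) * q₂)).twoTorsionCharH1 h'.swap₁₂ 0)) = 0 :=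
    ⟨zero_mem _, by rw [_root_.map_zero, _root_.map_zero, _root_.map_zero],
      by rw [_root_.map_zero, _root_.map_zero, _root_.map_zero]⟩
  haveI : Unique N :=
    { default := ⟨0, h0⟩
      uniq := fun x => by
        obtain ⟨a, b, ha, hb⟩ := (E.quadraticTwist ((q₁ : ℚ) * q₂)).exists_kummerEquiv_twoTorsionCharH1_pair_eq h' x.1
        apply Subtype.ext
        refine eq_zero_of_mem_selmerGroup_twist_pair E S h hS h2S hgood hN hrank hsha hq₁S hq₂S hne hq₁4 hq₂4 hM8 hsplit
          hδ₁₁ hδ₂₁ hδ₁₂ hδ₂₂ x.2.1 a b ha hb ?_ ?_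
        · rw [← (E.quadraticTwist ((q₁ : ℚ) * q₂)).parityHom_kummerEquiv_eq_parityBit h' q₁ ha]; exact x.2.2.1
        · rw [← (E.quadraticTwist ((q₁ : ℚ) * q₂)).parityHom_kummerEquiv_eq_parityBit h'.swap₁₂ q₁ hb]; exact x.2.2.2 }
  exact Nat.card_unique

end Summit.BirchSwinnertonDyer.BirchSwinnertonDyer.Theorems.GenusKolyvaginAtTwo.TorsionCellD0

end
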